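import Mathlib
import Literature.Analysis.FluidPDE.HardSphereCollisionRecord
import Literature.MathematicalPhysics.KineticTheory.HardSphereEuler
import Literature.MathematicalPhysics.KineticTheory.HardSphereEulerProofs
import Summits.AtomisticToContinuum.HydrodynamicLimit.Theses.OneFlightGossipEngine
import Summits.AtomisticToContinuum.HydrodynamicLimit.Theorems.OneFlightGossipEngineOneFlightLayeredChaosRegimes
import Summits.AtomisticToContinuum.HydrodynamicLimit.Theorems.OneFlightGossipEngineOneFlightLayeredChaosFirstFlightGhostInput
import Summits.AtomisticToContinuum.HydrodynamicLimit.Theorems.OneFlightGossipEngineOneFlightLayeredChaosTransQuasiInv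
import Summits.AtomisticToContinuum.HydrodynamicLimit.Theorems.OneFlightGossipEngineOneFlightLayeredChaosSplitGlue
import Summits.AtomisticToContinuum.HydrodynamicLimit.Theorems.OneFlightGossipEngineOneFlightLayeredChaosInputs
import HarnessLib

/-!
# `OneFlightGossipEngine.OneFlightLayeredChaos` — the Theses-free inputs ARE the line's inputs; glue over them
(crux stmt-AtomisticToContinuum-14535, line `Sketch`, lead cycle c4, brick B4, part 2; registered stubs
`oneFlightLayeredChaos_of_thesesFreeInputs`, `oneFlightLayeredChaos_of_thesesFreeTwoInputs`)

`…OneFlightLayeredChaosInputs.lean` restates the three inputs of line `Sketch` with no `Summits` import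
(`OLC.Inputs.FirstRungAt θ₀`, `OLC.Inputs.ShortGapAt θ₀`, `OLC.Inputs.LongGapAt θ₀`, merged form
`OLC.Inputs.NonzeroGapAt θ₀`), every `OLC` notion inlined verbatim. Here, with the `OLC` frame imported, the
restatements are identified with the originals by DEFINITIONAL UNFOLDING (`Iff.rfl` / `rfl`):
`Inputs.FirstRungAt θ₀ ↔ OLC.FirstFlightGhostInput θ₀`, `Inputs.shortGapSet = OLC.shortGap`,
`Inputs.TransQuasiInvAt θ₀ X ↔ OLC.RegimeTransQuasiInvBody θ₀ X`, and the three regime instances; and the glue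
`OLC.oneFlightLayeredChaos_of_inputs` / `…_of_two_inputs` (`…SplitGlue.lean`, p138438) is transported along them:
the crux `Theses.OneFlightGossipEngine.OneFlightLayeredChaos` BY NAME from
`∀ θ₀ > 0, Inputs.FirstRungAt θ₀`, `∀ θ₀ > 0, Inputs.ShortGapAt θ₀`, `∀ θ₀ > 0, Inputs.LongGapAt θ₀`
(`oneFlightLayeredChaos_of_thesesFreeInputs`), or from the first and `∀ θ₀ > 0, Inputs.NonzeroGapAt θ₀`
(`oneFlightLayeredChaos_of_thesesFreeTwoInputs`). These are the proofs of the GLUE ITEM of a split of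
stmt-AtomisticToContinuum-14535 into its (Theses-statable) inputs: once the route's Theses file declares
`def FirstRungInput : Prop := ∀ θ₀ : ℝ, 0 < θ₀ → OLC.Inputs.FirstRungAt θ₀` (etc., importing `…Inputs`), the crux
follows from those decls by these two theorems verbatim.
-/

open scoped BigOperators ENNReal Topology
open MeasureTheory Set Filter
open Literature.Analysis.FluidPDE Literature.MathematicalPhysics.KineticTheory
-- ===== (B) glue part =====

namespace Summit.AtomisticToContinuum.HydrodynamicLimit.Theorems.OLC

noncomputable section

/-! ## Bridges: the Theses-free restatements ARE the `OLC` inputs (definitional unfolding) -/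

/-- **The Theses-free first rung at `θ₀` is the first-flight ghost input** `OLC.FirstFlightGhostInput θ₀`
(definitional unfolding of `rhoStar`, `freeEntranceTime`, `firstFlightGhostEvent`). [folklore] -/
theorem Inputs.firstRungAt_iff (θ₀ : ℝ) : Inputs.FirstRungAt θ₀ ↔ FirstFlightGhostInput θ₀ :=
  Iff.rfl

/-- **The Theses-free short-gap regime is `OLC.shortGap`** (definitional unfolding of `mfTime`). [folklore] -/
theorem Inputs.shortGapSet_eq : Inputs.shortGapSet = shortGap :=
  rfl

/-- **Theses-free translation quasi-invariance on a regime is `OLC.RegimeTransQuasiInvBody`** (definitional unfolding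
of `RegimeTransQuasiInvTail`, `rhoStar`). [folklore] -/
theorem Inputs.transQuasiInvAt_iff (θ₀ : ℝ) (X : Regime) : Inputs.TransQuasiInvAt θ₀ X ↔ RegimeTransQuasiInvBody θ₀ X :=
  Iff.rfl

/-- **The Theses-free short-gap input at `θ₀` is translation quasi-invariance on the short-gap regime**
`shortGap θ₀ (1/20) ∩ (shortGap θ₀ 0)ᶜ` (definitional unfolding of `Regime.inter`, `Regime.compl`, `shortGap`).
[folklore] -/
theorem Inputs.shortGapAt_iff (θ₀ : ℝ) :
    Inputs.ShortGapAt θ₀ ↔ RegimeTransQuasiInvBody θ₀ ((shortGap θ₀ (1 / 20)).inter (shortGap θ₀ 0).compl) :=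
  Iff.rfl

/-- **The Theses-free long-gap input at `θ₀` is translation quasi-invariance on the long-gap regime**
`(shortGap θ₀ (1/20))ᶜ`. [folklore] -/
theorem Inputs.longGapAt_iff (θ₀ : ℝ) : Inputs.LongGapAt θ₀ ↔ RegimeTransQuasiInvBody θ₀ (shortGap θ₀ (1 / 20)).compl :=
  Iff.rfl

/-- **The Theses-free nonzero-gap input at `θ₀` is translation quasi-invariance on the nonzero-gap regime**
`(shortGap θ₀ 0)ᶜ`. [folklore] -/
theorem Inputs.nonzeroGapAt_iff (θ₀ : ℝ) : Inputs.NonzeroGapAt θ₀ ↔ RegimeTransQuasiInvBody θ₀ (shortGap θ₀ 0).compl :=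
  Iff.rfl

/-! ## The glue over the Theses-free inputs (registered stubs) -/

/-- **GLUE (three Theses-free inputs): the crux BY NAME** from `∀ θ₀ > 0, Inputs.FirstRungAt θ₀`,
`∀ θ₀ > 0, Inputs.ShortGapAt θ₀`, `∀ θ₀ > 0, Inputs.LongGapAt θ₀` (registered stub `oneFlightLayeredChaos_of_thesesFreeInputs`
of crux stmt-AtomisticToContinuum-14535, line `Sketch`, brick B4): the bridges above and `oneFlightLayeredChaos_of_inputs`
(p138438). The proof of the glue item of a split of stmt-14535 into the three Theses-free inputs. [folklore] -/
theorem oneFlightLayeredChaos_of_thesesFreeInputs : (∀ θ₀ : ℝ, 0 < θ₀ → Summit.AtomisticToContinuum.HydrodynamicLimit.Theorems.OLC.Inputs.FirstRungAt θ₀) → (∀ θ₀ : ℝ, 0 < θ₀ → Summit.AtomisticToContinuum.HydrodynamicLimit.Theorems.OLC.Inputs.ShortGapAt θ₀) → (∀ θ₀ : ℝ, 0 < θ₀ → Summit.AtomisticToContinuum.HydrodynamicLimit.Theorems.OLC.Inputs.LongGapAt θ₀) → Summit.AtomisticToContinuum.HydrodynamicLimit.Theses.OneFlightGossipEngine.OneFlightLayeredChaos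 :=
  fun h₁ h₂ h₃ =>
    oneFlightLayeredChaos_of_inputs (fun θ₀ hθ => (Inputs.firstRungAt_iff θ₀).1 (h₁ θ₀ hθ))
      (fun θ₀ hθ => (Inputs.shortGapAt_iff θ₀).1 (h₂ θ₀ hθ)) (fun θ₀ hθ => (Inputs.longGapAt_iff θ₀).1 (h₃ θ₀ hθ))

/-- **GLUE (two Theses-free inputs): the crux BY NAME** from `∀ θ₀ > 0, Inputs.FirstRungAt θ₀` and
`∀ θ₀ > 0, Inputs.NonzeroGapAt θ₀` (registered stub `oneFlightLayeredChaos_of_thesesFreeTwoInputs` of crux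
stmt-AtomisticToContinuum-14535, line `Sketch`, brick B4): the bridges above and `oneFlightLayeredChaos_of_two_inputs`
(p138438). [folklore] -/
theorem oneFlightLayeredChaos_of_thesesFreeTwoInputs : (∀ θ₀ : ℝ, 0 < θ₀ → Summit.AtomisticToContinuum.HydrodynamicLimit.Theorems.OLC.Inputs.FirstRungAt θ₀) → (∀ θ₀ : ℝ, 0 < θ₀ → Summit.AtomisticToContinuum.HydrodynamicLimit.Theorems.OLC.Inputs.NonzeroGapAt θ₀) → Summit.AtomisticToContinuum.HydrodynamicLimit.Theses.OneFlightGossipEngine.OneFlightLayeredChaos :=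
  fun h₁ h₂ =>
    oneFlightLayeredChaos_of_two_inputs (fun θ₀ hθ => (Inputs.firstRungAt_iff θ₀).1 (h₁ θ₀ hθ))
      (fun θ₀ hθ => (Inputs.nonzeroGapAt_iff θ₀).1 (h₂ θ₀ hθ))

end

end Summit.AtomisticToContinuum.HydrodynamicLimit.Theorems.OLC
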